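import Summits.SmoothPoincare4.SmoothPoincare4.Theses.WeakReductionDescent
import Literature.Topology.FourManifolds.SphereTrisectionsSectors
import Literature.Topology.FourManifolds.TrisectionFunctorGKNaturality

/-!
# SmoothPoincare4 / WeakReductionDescent — glue `MinimalWeaklyReducibleOfRungs`

Settles item stmt-SmoothPoincare4-18020 (support of route WeakReductionDescent, rev 4): the GLUE of
the rung split of the crux K1 `MinimalWeaklyReducible`,

  `DependentTripleAtThree → DependentTripleGenusThreeStandard → MinimalWeaklyReducibleFromFour →
   MinimalWeaklyReducible`.

Proof (pure logic over the route's own decls plus two PROVED tree theorems; it is the composition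
`minimalWeaklyReducible_of_pieces` of the registered skeleton
`Cruxes/MinimalWeaklyReducible/Lines/rung_split.lean`, copied into `Theorems/`): let `T` be a
GK-trisection of genus `g ≥ 3` of the smooth homotopy 4-sphere `M` (bare binders, `e : M ≃ₕ S⁴`)
which is of minimal genus among the GK-trisections of `M`.
* `g = 3`: `DependentTripleAtThree` (X₁) gives a dependent triple on the central surface, and
  `DependentTripleGenusThreeStandard` (X_F, Aranda–Zupan 2025 Thm 1.4 in homotopy-sphere form) turns
  it into a diffeomorphism `Φ : M ≅ S⁴`.  Gay–Kirby's genus-`0` trisection of the round sphere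
  (`Literature.Topology.FourManifolds.sphere_genusZero_gkTrisection_holds`, PROVED) transported
  along `Φ⁻¹` (`Literature.Topology.FourManifolds.IsGKTrisection.image_diffeomorph'`, PROVED) is a
  GK-trisection of `M` of genus `0`, so minimality gives `3 ≤ 0` — the rung is vacuous.
* `g ≥ 4`: `MinimalWeaklyReducibleFromFour` (X₂) verbatim.
No named-fact hypotheses: the theorem is unconditional (its three antecedents are route items).
-/

namespace Summit.SmoothPoincare4.SmoothPoincare4.Theorems

open scoped Manifold ContDiff ContinuousMap
open Summit.SmoothPoincare4.SmoothPoincare4.Theses.WeakReductionDescent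
open Literature.Topology.FourManifolds

/-- **A smooth 4-manifold diffeomorphic to the round `S⁴` has no minimal GK-trisection of genus
`≥ 1`.** Gay–Kirby's genus-`0` trisection of `S⁴`
(`Literature.Topology.FourManifolds.sphere_genusZero_gkTrisection_holds`) pulls back along the
diffeomorphism (`Literature.Topology.FourManifolds.IsGKTrisection.image_diffeomorph'`) to a
GK-trisection of `M` of genus `0`, so a genus `g ≥ 1` can not be minimal.
[cite: GayKirby2016, §2 (first example) and Def. 1] -/
theorem not_minimalGenus_of_diffeomorph_sphere {M : Type} [TopologicalSpace M]
    [ChartedSpace (EuclideanSpace ℝ (Fin 4)) M] [IsManifold (𝓡 4) ((⊤ : ℕ∞) : WithTop ℕ∞) M]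
    (Φ : Diffeomorph (𝓡 4) (𝓡 4) M (Metric.sphere (0 : EuclideanSpace ℝ (Fin 5)) 1)
      ((⊤ : ℕ∞) : WithTop ℕ∞))
    {g : ℕ} (hg : 1 ≤ g)
    (hmin : ∀ (g' : ℕ) (k' : Fin 3 → ℕ) (T' : Fin 3 → Set M), IsGKTrisection M g' k' T' → g ≤ g') :
    False := by
  obtain ⟨S₀, hS₀⟩ := sphere_genusZero_gkTrisection_holds
  have h0 : IsGKTrisection M 0 (fun _ => 0) (fun i => Φ.symm '' S₀ i) :=
    hS₀.isGKTrisection.image_diffeomorph' Φ.symm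
  have := hmin 0 _ _ h0
  omega

/-- Settles stmt-SmoothPoincare4-18020: the glue `MinimalWeaklyReducibleOfRungs` of the rung split
of the crux `MinimalWeaklyReducible` — `DependentTripleAtThree → DependentTripleGenusThreeStandard →
MinimalWeaklyReducibleFromFour → MinimalWeaklyReducible`.  At `g = 3` the dependent triple (X₁) and
Aranda–Zupan 2025 Thm 1.4 (X_F) give `M ≅ S⁴`, which contradicts minimality
(`not_minimalGenus_of_diffeomorph_sphere`), so rung `3` holds vacuously; at `g ≥ 4` the third
antecedent (X₂) is the claim verbatim.
[cite: GayKirby2016, §2 (first example)] [cite: ArandaZupan2025, Thm. 1.4 (p. 2, §7)] -/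
theorem MinimalWeaklyReducibleOfRungs_proof :
    Summit.SmoothPoincare4.SmoothPoincare4.Theses.WeakReductionDescent.MinimalWeaklyReducibleOfRungs := by
  unfold MinimalWeaklyReducibleOfRungs
  intro h₁ hF h₂
  unfold MinimalWeaklyReducible
  intro M _ _ _ _ _ e g k T hT hg hmin
  rcases Nat.lt_or_ge g 4 with hlt | hge
  · obtain rfl : g = 3 := by omega
    have hDT := h₁ M e k T hT hmin
    obtain ⟨Φ⟩ := hF M e k T hT hDT
    exact (not_minimalGenus_of_diffeomorph_sphere Φ (by norm_num) hmin).elim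
  · exact h₂ M e g k T hT hge hmin

end Summit.SmoothPoincare4.SmoothPoincare4.Theorems
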